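import Summits.CriticalPhenomena.Ising3D.TaylorFunctionalZSeries
import Mathlib.Tactic.Linarith
import Mathlib.Tactic.Positivity
import Mathlib.Tactic.Ring
import HarnessLib

/-!
# Closed form of a derivative functional on one `z`-series term: `taylorCoeffAt (x,x) (a,b) F^s_σ[𝒫_{E,j}]`
(cell `pub-ising3x`, seat boot-1; gate (g0′) of the M3-γ milestone — the producer/kernel side of a
γ-certificate: what the rational tables must reproduce)

HONEST FRAMING: lottery ticket; floor = tightest certified 3D Ising CFT bounds; no exact-solution
claim without a proof.

`IsTaylorFunctional.hasSum_crossF_hrZTerm` (part (g0′′)) reduces a derivative functional's value on a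
block to the series of its values on the terms `crossF s σ 𝒫_{E,j}`, `𝒫_{E,j} = (z z̄)^{(E-j)/2} 𝒫_j`. Here
those values are made EXPLICIT AND FINITE (`taylorCoeffAt_crossF_zMono`): with `τ = (E-j)/2`,
`taylorCoeffAt x x (a,b) (crossF s σ 𝒫_{E,j}) = Σ_{p₁+p₂=j} λ_{p₁} λ_{p₂} [c¹_{p₁}(a) c¹_{p₂}(b) + σ c²_{p₁}(a) c²_{p₂}(b)]`,
`c¹_m(a) = Σ_{i+i'=a} oneSubGerm s x i · rpowGerm (τ+m) x i'` (germ of `(1-z)^s z^{τ+m}`),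
`c²_m(a) = Σ_{i+i'=a} rpowGerm s x i · oneSubGerm (τ+m) x i'` (germ of `z^s (1-z)^{τ+m}`), where
`rpowGerm α x i = x^α (-1)^i C(α,i) (-x⁻¹)^i`, `oneSubGerm α x i = (1-x)^α (-1)^i C(α,i) (1-x)^{-i}` — finite
rational combinations of binomial coefficients `Ring.choose` (polynomial in `α`) times the positive
prefactors `x^α`, `(1-x)^α`: at `x = ½` exactly the `2^{-E} 4^{-s} q(E, j, s)` structure of the cell's
q-polynomial tables (pub-ising3d `qpoly.py`). Ingredients: the explicit germs `hasTaylorGerm_term₁/₂`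
(`BlockTaylorGerm`), finiteness of `zLegendreArr`, the computation rule `taylorCoeffAt_eq`.
Sources: Hogervorst–Rychkov 2013 §3 eq. (3.6); Kos–Poland–Simmons-Duffin 2014 §3.3 (derivative basis).
-/

namespace Summit.CriticalPhenomena.Ising3D

open Finset Set
open Literature.MathematicalPhysics.QuantumFieldTheory.ConformalBootstrap3D

/-- A `dsCoeff` with a finitely supported array is a finite sum. [folklore] -/
theorem dsCoeff_eq_sum {k : ℕ × ℕ → ℝ} {c d : ℕ → ℕ → ℝ} (S : Finset (ℕ × ℕ))
    (hk : ∀ p ∉ S, k p = 0) (ab : ℕ × ℕ) :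
    dsCoeff k c d ab = ∑ p ∈ S, k p * c p.1 ab.1 * d p.2 ab.2 := by
  unfold dsCoeff
  exact tsum_eq_sum fun p hp => by rw [hk p hp, zero_mul, zero_mul]

/-- The germ coefficients of `z ↦ (1-z)^s z^α` at `x` (term 1 factor). [folklore] -/
noncomputable def factor₁Germ (s α x : ℝ) (a : ℕ) : ℝ :=
  ∑ ij ∈ antidiagonal a, oneSubGerm s x ij.1 * rpowGerm α x ij.2

/-- The germ coefficients of `z ↦ z^s (1-z)^α` at `x` (term 2 factor). [folklore] -/
noncomputable def factor₂Germ (s α x : ℝ) (a : ℕ) : ℝ :=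
  ∑ ij ∈ antidiagonal a, rpowGerm s x ij.1 * oneSubGerm α x ij.2

/-- **The Taylor germ of `crossF s σ 𝒫_{E,j}` at `(x,x)`, explicitly** (radius `x(1-x)`):
`T = dsCoeff (zLegendreArr j) c¹ c¹ + σ • dsCoeff (zLegendreArr j) c² c²`. [folklore] -/
theorem hasTaylorGerm_crossF_zMono {x : ℝ} (hx0 : 0 < x) (hx1 : x < 1) (s σ E : ℝ) (j : ℕ)
    (hEj : (j : ℝ) ≤ E) :
    HasTaylorGerm (crossF s σ (zMono E j)) x x (x * (1 - x))
      (dsCoeff (zLegendreArr j) (fun m => factor₁Germ s ((E - (j : ℝ)) / 2 + m) x)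
          (fun m => factor₁Germ s ((E - (j : ℝ)) / 2 + m) x) +
        σ • dsCoeff (zLegendreArr j) (fun m => factor₂Germ s ((E - (j : ℝ)) / 2 + m) x)
          (fun m => factor₂Germ s ((E - (j : ℝ)) / 2 + m) x)) := by
  have hτ : 0 ≤ (E - (j : ℝ)) / 2 := by linarith
  have hK := isDoublePowerSeriesOn_zLegendreArr j
  have hg : ∀ z zb : ℝ, z ∈ Ioo (0 : ℝ) 1 → zb ∈ Ioo (0 : ℝ) 1 →
      zMono E j z zb = (z * zb) ^ ((E - (j : ℝ)) / 2) * zLegendre j z zb := fun _ _ _ _ => rfl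
  have h₁ := (hasTaylorGerm_term₁ hK hτ hx0 hx1 hg s).1
  have h₂ := (hasTaylorGerm_term₂ hK hτ hx0 hx1 hg s).1
  have hsum := h₁.add (h₂.smul σ)
  have hfun : ((fun z zb => ((1 - z) * (1 - zb)) ^ s * zMono E j z zb) +
      σ • fun z zb => (z * zb) ^ s * zMono E j (1 - z) (1 - zb)) = crossF s σ (zMono E j) := by
    funext z zb
    simp only [Pi.add_apply, Pi.smul_apply, smul_eq_mul, crossF]
    ring
  rw [hfun] at hsum
  exact hsum

/-- **(g0′) Closed form.** For `0 < x < 1`, `j ≤ E`, every `(a,b)`: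
`taylorCoeffAt x x (a,b) (crossF s σ 𝒫_{E,j}) =
 Σ_{(p₁,p₂): p₁+p₂=j} λ_{p₁} λ_{p₂} (c¹_{p₁}(a) c¹_{p₂}(b) + σ c²_{p₁}(a) c²_{p₂}(b))`,
`cⁱ_m = factorᵢGerm s ((E-j)/2 + m) x` — a finite expression in binomial coefficients.
[cite: KosPolandSimmonsduffin2014, §3.3 eq. (3.17)] -/
theorem taylorCoeffAt_crossF_zMono {x : ℝ} (hx0 : 0 < x) (hx1 : x < 1) (s σ E : ℝ) (j : ℕ)
    (hEj : (j : ℝ) ≤ E) (ab : ℕ × ℕ) :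
    taylorCoeffAt x x ab (crossF s σ (zMono E j)) =
      ∑ p ∈ antidiagonal j, legendreLam p.1 * legendreLam p.2 *
        (factor₁Germ s ((E - (j : ℝ)) / 2 + p.1) x ab.1 * factor₁Germ s ((E - (j : ℝ)) / 2 + p.2) x ab.2 +
          σ * (factor₂Germ s ((E - (j : ℝ)) / 2 + p.1) x ab.1 *
            factor₂Germ s ((E - (j : ℝ)) / 2 + p.2) x ab.2)) := by
  rw [taylorCoeffAt_eq (hasTaylorGerm_crossF_zMono hx0 hx1 s σ E j hEj) ab, Pi.add_apply,
    Pi.smul_apply, smul_eq_mul,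
    dsCoeff_eq_sum (antidiagonal j) (fun p hp => zLegendreArr_eq_zero hp),
    dsCoeff_eq_sum (antidiagonal j) (fun p hp => zLegendreArr_eq_zero hp), Finset.mul_sum,
    ← Finset.sum_add_distrib]
  refine Finset.sum_congr rfl fun p hp => ?_
  rw [zLegendreArr, if_pos (mem_antidiagonal.mp hp)]
  ring

/-- The factor germs, unfolded to binomial coefficients: `rpowGerm α x i = x^α ((-1)^i C(α,i)) (-x⁻¹)^i`.
[folklore] -/
theorem rpowGerm_eq (α x : ℝ) (i : ℕ) :
    rpowGerm α x i = x ^ α * ((-1) ^ i * Ring.choose α i) * (-x⁻¹) ^ i := rfl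

/-- `oneSubGerm α x i = (1-x)^α ((-1)^i C(α,i)) ((1-x)⁻¹)^i`. [folklore] -/
theorem oneSubGerm_eq (α x : ℝ) (i : ℕ) :
    oneSubGerm α x i = (1 - x) ^ α * ((-1) ^ i * Ring.choose α i) * ((1 - x)⁻¹) ^ i := rfl

end Summit.CriticalPhenomena.Ising3D
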